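import Mathlib
import Summits.NavierStokesRegularity.NavierStokesRegularity.Theorems.DssFarFieldSlavingBlowupTypeIDssProfileGaussianIBP
import HarnessLib

/-!
# The Gaussian head-pressure identity (E_G) for one slice of the rotated profile system
  (pub-ns-dss theory T42; route `DssFarFieldSlaving`, crux `BlowupTypeIDssProfile`,
  stmt-NavierStokesRegularity-0155 — SUPPORT; cell pub-ns-dss, typer seat g4, 2026-08-22; part 2,
  imports `…GaussianIBP.lean`)

HONEST FRAMING. Nothing here is new analysis and nothing here is a statement about Navier–Stokes
regularity or blow-up. The identity below is Pineau–Vicol 2026, §7.4 (the display after (7.9)) —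
in the tree `PineauVicol2026.integral_weight_mul_norm_curl_sq_slice` — specialised to the reference
field `Ū = 0`, whose adjoint weight is the EXPLICIT Gaussian `γ(y) = e^{−|y|²/4}` (the tree's
`PineauVicol2026.gaussWeight`; `Δγ + div(γ · ½y) = 0`, `gaussWeight_mem_adjointKernel_zero`),
followed by the two Gaussian integrations by parts of part 1 (`∫ γ DΠ[U] = ½ ∫ γ ⟪y, U⟫ Π`,
`∫ γ E = 0`). Result, for one slice `(U, P)` with time derivative `U_s` and head pressure
`Π = ½|U|² + P + ½⟪y, U⟫` (`headPressure (1/2) U P`):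

  (E_G)   `∫ γ |curl U|² dy + ∫ γ ⟪U + ½y, U_s⟫ dy = −½ ∫ γ ⟪y, U⟫ Π dy`.

This is the statement `GaussianHeadPressureSlice` of the cell's theory seat (file
theory/GaussianHeadPressureStatements.lean sha256[16] ef0e7dd54c453371, red g14 ×2 PASS s15(a)(b)(c)(e))
with its local `rho` replaced by the tree's definitionally equal `PineauVicol2026.gaussWeight`; the
hypotheses are exactly the theory seat's (smooth `U, P`, `C¹` time derivative `U_s`, the slice
equation, `div U = 0`, the pressure Poisson equation in trace form, and the polynomial bounds
`|U| ≤ C`, `‖DU‖ ≤ C`, `|U_s| ≤ C(1+|y|)`, `|P| ≤ C(1+|y|)`, `‖∇P‖ ≤ C(1+|y|)`); the variant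
`gaussianHeadPressure_slice_poly` takes the last three bounds of any polynomial degree `N` (the
tree's class-level bounds on `∂_sU`, `P`, `∇P` are cubic; the identity does not see the degree). For a genuine
time-dependent profile `∫ γ ⟪U + ½y, ∂_sU⟫ = d/ds ½∫ γ |U|²` (since `∫ γ ⟪y, U⟫ = 0` for
`div U = 0`); that reading, the period average, and the sign cell E33 are NOT in this file.
Census use (cell pub-ns-dss, NULL-TESTS n21): the identity index `R_Π = 1` and the sign law for K1
rows become instances of a tree theorem at the explicit weight. [cite: PineauVicol2026, §7.4, display after (7.9) (p. 26)]
-/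

noncomputable section

set_option linter.dupNamespace false

namespace Summit.NavierStokesRegularity.NavierStokesRegularity.Theorems.GaussianHeadPressure

open Set Function Filter MeasureTheory InnerProductSpace
open scoped RealInnerProductSpace Laplacian ContDiff Topology BigOperators
open Literature.Analysis Literature.Analysis.FluidPDE Literature.Analysis.FluidPDE.PineauVicol2026
open Summit.NavierStokesRegularity.NavierStokesRegularity.Theorems

/-! ### (E_G) -/

/-- **(E_G) with polynomial bounds of any degree `N` on `U_s`, `P`, `∇P`** (the identity is
insensitive to the degree: every term is integrated against `e^{−|y|²/4}`; degree `N = 1` is the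
theory seat's statement `gaussianHeadPressureSlice` below, higher degrees serve the tree's class-level
bounds, which are cubic).
For a smooth slice `(U, P)` of Pineau–Vicol's rotated time-dependent profile system (1.14a) with time
derivative `U_s` and angular speed `α` — `U_s + α(JU − DU[Jy]) + ½U + ½DU[y] − ΔU + DU[U] + ∇P = 0`,
`div U = 0`, `ΔP = −tr((∇U)²)` — and the polynomial bounds `|U| ≤ C`, `‖DU‖ ≤ C`,
`|U_s| ≤ C(1+|y|)`, `|P| ≤ C(1+|y|)`, `‖∇P‖ ≤ C(1+|y|)` (Gaussian integrability), with
`γ(y) = e^{−|y|²/4}` and `Π = ½|U|² + P + ½⟪y, U⟫`: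
`∫ γ |curl U|² + ∫ γ ⟪U + ½y, U_s⟫ = −½ ∫ γ ⟪y, U⟫ Π`.
The rotation term drops out (`∫ γE = 0`) and `α` does not appear. Proof:
`PineauVicol2026.integral_weight_mul_norm_curl_sq_slice` with `Ū = 0`, `w = γ`
(`gaussWeight_mem_adjointKernel_zero`), then `integral_gaussWeight_mul_fderiv_headPressure` and
`integral_gaussWeight_mul_rotationTerm_eq_zero`.
[cite: PineauVicol2026, §7.4, display after (7.9) (p. 26)] -/
theorem gaussianHeadPressure_slice_poly {N : ℕ}
    {U Us : EuclideanSpace ℝ (Fin 3) → EuclideanSpace ℝ (Fin 3)} {P : EuclideanSpace ℝ (Fin 3) → ℝ}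
    {α C : ℝ} (hU : ContDiff ℝ ∞ U) (hP : ContDiff ℝ ∞ P) (hUs : ContDiff ℝ 1 Us)
    (heq : ∀ y, Us y + α • (rotGen (U y) - fderiv ℝ U y (rotGen y)) + (1 / 2 : ℝ) • U y +
      (1 / 2 : ℝ) • fderiv ℝ U y y - (Δ U) y + convect U U y + gradient P y = 0)
    (hdiv : VectorCalculus.IsDivFree U)
    (hΔP : ∀ y, ∑ l, pderiv l (pderiv l P) y =
      -∑ l, ∑ j, pderiv l (fun z => U z j) y * pderiv j (fun z => U z l) y)
    (hUb : ∀ y, ‖U y‖ ≤ C) (hDUb : ∀ y, ‖fderiv ℝ U y‖ ≤ C)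
    (hUsb : ∀ y, ‖Us y‖ ≤ C * (1 + ‖y‖) ^ N) (hPb : ∀ y, |P y| ≤ C * (1 + ‖y‖) ^ N)
    (hgPb : ∀ y, ‖gradient P y‖ ≤ C * (1 + ‖y‖) ^ N) :
    (∫ y, gaussWeight y * ‖curl U y‖ ^ 2) +
        ∫ y, gaussWeight y * ⟪U y + (1 / 2 : ℝ) • y, Us y⟫ =
      -(1 / 2 : ℝ) * ∫ y, gaussWeight y * (⟪y, U y⟫ * headPressure (1 / 2) U P y) := by
  have hC : 0 ≤ C := (norm_nonneg _).trans (hUb 0)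
  set H : EuclideanSpace ℝ (Fin 3) → ℝ := headPressure (1 / 2) U P with hHdef
  have hU1 : ContDiff ℝ 1 U := hU.of_le (by norm_cast)
  have hUd : Differentiable ℝ U := hU1.differentiable one_ne_zero
  have hPd : Differentiable ℝ P := (hP.of_le (by norm_cast : (1 : WithTop ℕ∞) ≤ ∞)).differentiable one_ne_zero
  have hγ2 : ContDiff ℝ 2 (gaussWeight : EuclideanSpace ℝ (Fin 3) → ℝ) := contDiff_gaussWeight
  -- pointwise bounds
  have hHb : ∀ y, |H y| ≤ (C ^ 2 + C + C) * (1 + ‖y‖) ^ (N + 1) := fun y =>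
    abs_headPressure_le_poly hC hUb hPb y
  have hgHb : ∀ y, ‖gradient H y‖ ≤ (C * C + C + C + C) * (1 + ‖y‖) ^ (N + 1) := fun y =>
    norm_gradient_headPressure_le_poly hUd hPd hC hUb hDUb (norm_fderiv_le_of_gradient hgPb) y
  have hEb : ∀ y, |(1 / 2 : ℝ) * ⟪rotGen y, U y⟫ + ⟪U y + (1 / 2 : ℝ) • y, fderiv ℝ U y (rotGen y)⟫|
      ≤ (C + 1) * (C + C) * (1 + ‖y‖) ^ 2 := fun y => rotationDefect_abs_errorTerm_le_sq hC hUb hDUb y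
  have hdrift : ∀ y, ‖U y + (1 / 2 : ℝ) • y‖ ≤ (C + 1) * (1 + ‖y‖) := fun y =>
    rotationDefect_norm_drift_le hC hUb y
  -- continuity
  have cγ : Continuous (gaussWeight : EuclideanSpace ℝ (Fin 3) → ℝ) := continuous_gaussWeight
  have cU : Continuous U := hU.continuous
  have cUs : Continuous Us := hUs.continuous
  have cDU : Continuous (fderiv ℝ U) := hU.continuous_fderiv (by simp)
  have cJ : Continuous (rotGen : EuclideanSpace ℝ (Fin 3) → EuclideanSpace ℝ (Fin 3)) :=
    rotGenL.continuous
  have cH : Continuous H := (contDiff_headPressure hU hP _).continuous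
  have cgH : Continuous (gradient H) := (PineauVicol2026.contDiff_gradient (n := 0)
    ((contDiff_headPressure hU hP _).of_le (by norm_cast))).continuous
  have ccurl : Continuous (curl U) := continuous_curl hU1
  -- the seven integrability hypotheses of the tree theorem, for `w = γ`, `Ū = 0`
  have iΩ : Integrable fun y => gaussWeight y * ‖curl U y‖ ^ 2 := by
    refine integrable_of_le_poly_gaussWeight (cγ.mul ((continuous_norm.comp ccurl).pow 2))
      (K := (‖curlCLM‖ * C) ^ 2) (N := 0) fun y => ?_
    rw [Real.norm_eq_abs, abs_mul, abs_of_pos (gaussWeight_pos y), abs_of_nonneg (by positivity),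
      pow_zero, mul_one, mul_comm]
    exact mul_le_mul_of_nonneg_right (rotationDefect_norm_curl_sq_le hDUb y) (gaussWeight_pos y).le
  have iE : Integrable fun y => gaussWeight y * ((1 / 2 : ℝ) * ⟪rotGen y, U y⟫ +
      ⟪U y + (1 / 2 : ℝ) • y, fderiv ℝ U y (rotGen y)⟫) := by
    have cE : Continuous fun y => (1 / 2 : ℝ) * ⟪rotGen y, U y⟫ +
        ⟪U y + (1 / 2 : ℝ) • y, fderiv ℝ U y (rotGen y)⟫ := by fun_prop
    refine integrable_of_le_poly_gaussWeight (cγ.mul cE) (K := (C + 1) * (C + C)) (N := 2)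
      fun y => ?_
    rw [Real.norm_eq_abs, abs_mul, abs_of_pos (gaussWeight_pos y)]
    calc gaussWeight y * |(1 / 2 : ℝ) * ⟪rotGen y, U y⟫ +
          ⟪U y + (1 / 2 : ℝ) • y, fderiv ℝ U y (rotGen y)⟫|
        ≤ gaussWeight y * ((C + 1) * (C + C) * (1 + ‖y‖) ^ 2) :=
          mul_le_mul_of_nonneg_left (hEb y) (gaussWeight_pos y).le
      _ = (C + 1) * (C + C) * (1 + ‖y‖) ^ 2 * gaussWeight y := by ring
  have iT : Integrable fun y => gaussWeight y * ⟪U y + (1 / 2 : ℝ) • y, Us y⟫ := by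
    refine integrable_of_le_poly_gaussWeight (by fun_prop) (K := (C + 1) * C) (N := N + 1)
      fun y => ?_
    rw [Real.norm_eq_abs, abs_mul, abs_of_pos (gaussWeight_pos y)]
    have h1 : |⟪U y + (1 / 2 : ℝ) • y, Us y⟫| ≤ (C + 1) * (1 + ‖y‖) * (C * (1 + ‖y‖) ^ N) :=
      (abs_real_inner_le_norm _ _).trans
        (mul_le_mul (hdrift y) (hUsb y) (norm_nonneg _) (by positivity))
    calc gaussWeight y * |⟪U y + (1 / 2 : ℝ) • y, Us y⟫|
        ≤ gaussWeight y * ((C + 1) * (1 + ‖y‖) * (C * (1 + ‖y‖) ^ N)) :=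
          mul_le_mul_of_nonneg_left h1 (gaussWeight_pos y).le
      _ = (C + 1) * C * (1 + ‖y‖) ^ (N + 1) * gaussWeight y := by ring
  have iF : Integrable fun y => gaussWeight y *
      fderiv ℝ H y (U y - (0 : EuclideanSpace ℝ (Fin 3) → EuclideanSpace ℝ (Fin 3)) y) := by
    simp only [Pi.zero_apply, sub_zero]
    have e : (fun y => gaussWeight y * fderiv ℝ H y (U y)) =
        fun y => gaussWeight y * ⟪gradient H y, U y⟫ := by
      funext y; rw [inner_gradient_left]
    rw [e]
    refine integrable_of_le_poly_gaussWeight (cγ.mul (cgH.inner cU)) (K := (C * C + C + C + C) * C)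
      (N := N + 1) fun y => ?_
    rw [Real.norm_eq_abs, abs_mul, abs_of_pos (gaussWeight_pos y)]
    have h1 : |⟪gradient H y, U y⟫| ≤ (C * C + C + C + C) * (1 + ‖y‖) ^ (N + 1) * C :=
      (abs_real_inner_le_norm _ _).trans (mul_le_mul (hgHb y) (hUb y) (norm_nonneg _) (by positivity))
    calc gaussWeight y * |⟪gradient H y, U y⟫|
        ≤ gaussWeight y * ((C * C + C + C + C) * (1 + ‖y‖) ^ (N + 1) * C) :=
          mul_le_mul_of_nonneg_left h1 (gaussWeight_pos y).le
      _ = (C * C + C + C + C) * C * (1 + ‖y‖) ^ (N + 1) * gaussWeight y := by ring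
  have h₁ : Integrable fun y => |gaussWeight y| * ‖gradient H y‖ := by
    refine integrable_of_le_poly_gaussWeight ((continuous_abs.comp cγ).mul (continuous_norm.comp cgH))
      (K := C * C + C + C + C) (N := N + 1) fun y => ?_
    rw [Real.norm_eq_abs, abs_mul, abs_abs, abs_of_pos (gaussWeight_pos y), abs_of_nonneg (norm_nonneg _)]
    calc gaussWeight y * ‖gradient H y‖
        ≤ gaussWeight y * ((C * C + C + C + C) * (1 + ‖y‖) ^ (N + 1)) :=
          mul_le_mul_of_nonneg_left (hgHb y) (gaussWeight_pos y).le
      _ = (C * C + C + C + C) * (1 + ‖y‖) ^ (N + 1) * gaussWeight y := by ring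
  have h₂ : Integrable fun y => |H y| * ‖gradient gaussWeight y‖ := by
    have cgγ : Continuous (gradient (gaussWeight : EuclideanSpace ℝ (Fin 3) → ℝ)) :=
      (PineauVicol2026.contDiff_gradient (n := 0) (contDiff_gaussWeight (n := 1))).continuous
    refine integrable_of_le_poly_gaussWeight ((continuous_abs.comp cH).mul (continuous_norm.comp cgγ))
      (K := (C ^ 2 + C + C) * (1 / 2)) (N := N + 2) fun y => ?_
    rw [Real.norm_eq_abs, abs_mul, abs_abs, abs_of_nonneg (norm_nonneg _), gradient_gaussWeight,
      norm_smul, Real.norm_eq_abs, abs_mul, abs_neg, abs_of_pos (by norm_num : (0:ℝ) < 1 / 2),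
      abs_of_pos (gaussWeight_pos y)]
    have hy : ‖y‖ ≤ 1 + ‖y‖ := by linarith [norm_nonneg y]
    have hγ0 := (gaussWeight_pos y).le
    calc |H y| * ((1 / 2 : ℝ) * gaussWeight y * ‖y‖)
        ≤ (C ^ 2 + C + C) * (1 + ‖y‖) ^ (N + 1) * ((1 / 2 : ℝ) * gaussWeight y * (1 + ‖y‖)) :=
          mul_le_mul (hHb y) (mul_le_mul_of_nonneg_left hy (by positivity)) (by positivity)
            (by positivity)
      _ = (C ^ 2 + C + C) * (1 / 2) * (1 + ‖y‖) ^ (N + 2) * gaussWeight y := by ring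
  have h₃ : Integrable fun y => |H y| * |gaussWeight y| *
      ‖(0 : EuclideanSpace ℝ (Fin 3) → EuclideanSpace ℝ (Fin 3)) y + (1 / 2 : ℝ) • y‖ := by
    simp only [Pi.zero_apply, zero_add]
    refine integrable_of_le_poly_gaussWeight (by fun_prop) (K := (C ^ 2 + C + C) * (1 / 2))
      (N := N + 2) fun y => ?_
    rw [Real.norm_eq_abs, abs_mul, abs_mul, abs_abs, abs_abs, abs_of_pos (gaussWeight_pos y),
      abs_of_nonneg (norm_nonneg _), norm_smul, Real.norm_eq_abs,
      abs_of_pos (by norm_num : (0:ℝ) < 1 / 2)]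
    have hy : ‖y‖ ≤ 1 + ‖y‖ := by linarith [norm_nonneg y]
    have hγ0 := (gaussWeight_pos y).le
    calc |H y| * gaussWeight y * ((1 / 2 : ℝ) * ‖y‖)
        ≤ (C ^ 2 + C + C) * (1 + ‖y‖) ^ (N + 1) * gaussWeight y * ((1 / 2 : ℝ) * (1 + ‖y‖)) :=
          mul_le_mul (mul_le_mul_of_nonneg_right (hHb y) (gaussWeight_pos y).le)
            (mul_le_mul_of_nonneg_left hy (by norm_num)) (by positivity) (by positivity)
      _ = (C ^ 2 + C + C) * (1 / 2) * (1 + ‖y‖) ^ (N + 2) * gaussWeight y := by ring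
  -- the tree identity with `Ū = 0`, `w = γ`
  have h79 := integral_weight_mul_norm_curl_sq_slice
    (Ubar := (0 : EuclideanSpace ℝ (Fin 3) → EuclideanSpace ℝ (Fin 3))) hU hP contDiff_const hγ2
    heq hdiv hΔP gaussWeight_mem_adjointKernel_zero iΩ iE iT iF h₁ h₂ h₃
  have hrot := integral_gaussWeight_mul_rotationTerm_eq_zero hU hUb hDUb
  have hhead := integral_gaussWeight_mul_fderiv_headPressure hU hP hdiv hUb hDUb hPb hgPb
  simp only [Pi.zero_apply, sub_zero] at h79
  rw [hrot, hhead, mul_zero, add_zero] at h79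
  linarith


/-- **T42 (E_G): the Gaussian head-pressure identity for one slice of the rotated profile system** —
the cell's theory statement `GaussianHeadPressureSlice` (HOME/theory/GaussianHeadPressureStatements.lean
sha256[16] ef0e7dd54c453371) binder for binder, with its local `rho` replaced by the tree's
`PineauVicol2026.gaussWeight` (literally the same term `Real.exp (-‖y‖ ^ 2 / 4)`).
For a smooth slice `(U, P)` of Pineau–Vicol's rotated time-dependent profile system (1.14a) with time
derivative `U_s` and angular speed `α` — `U_s + α(JU − DU[Jy]) + ½U + ½DU[y] − ΔU + DU[U] + ∇P = 0`,
`div U = 0`, `ΔP = −tr((∇U)²)` — and the polynomial bounds `|U| ≤ C`, `‖DU‖ ≤ C`,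
`|U_s| ≤ C(1+|y|)`, `|P| ≤ C(1+|y|)`, `‖∇P‖ ≤ C(1+|y|)` (Gaussian integrability), with
`γ(y) = e^{−|y|²/4}` and `Π = ½|U|² + P + ½⟪y, U⟫`:
`∫ γ |curl U|² + ∫ γ ⟪U + ½y, U_s⟫ = −½ ∫ γ ⟪y, U⟫ Π`.
The rotation term drops out (`∫ γE = 0`) and `α` does not appear. Proof:
`PineauVicol2026.integral_weight_mul_norm_curl_sq_slice` with `⟨U⟩_s := 0`, `w̄ := γ`
(`gaussWeight_mem_adjointKernel_zero`), then `integral_gaussWeight_mul_fderiv_headPressure` and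
`integral_gaussWeight_mul_rotationTerm_eq_zero` (degree `N = 1` of `gaussianHeadPressure_slice_poly`).
[cite: PineauVicol2026, §7.4, display after (7.9) (p. 26)] -/
theorem gaussianHeadPressureSlice :
    ∀ (U Us : EuclideanSpace ℝ (Fin 3) → EuclideanSpace ℝ (Fin 3)) (P : EuclideanSpace ℝ (Fin 3) → ℝ)
      (α C : ℝ),
    ContDiff ℝ ∞ U → ContDiff ℝ ∞ P → ContDiff ℝ 1 Us →
    (∀ y, Us y + α • (rotGen (U y) - fderiv ℝ U y (rotGen y)) + (1 / 2 : ℝ) • U y +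
      (1 / 2 : ℝ) • fderiv ℝ U y y - (Δ U) y + convect U U y + gradient P y = 0) →
    VectorCalculus.IsDivFree U →
    (∀ y, ∑ l, pderiv l (pderiv l P) y =
      -∑ l, ∑ j, pderiv l (fun z => U z j) y * pderiv j (fun z => U z l) y) →
    (∀ y, ‖U y‖ ≤ C) → (∀ y, ‖fderiv ℝ U y‖ ≤ C) → (∀ y, ‖Us y‖ ≤ C * (1 + ‖y‖)) →
    (∀ y, |P y| ≤ C * (1 + ‖y‖)) → (∀ y, ‖gradient P y‖ ≤ C * (1 + ‖y‖)) →
    (∫ y, gaussWeight y * ‖curl U y‖ ^ 2) + ∫ y, gaussWeight y * ⟪U y + (1 / 2 : ℝ) • y, Us y⟫ =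
      -(1 / 2 : ℝ) * ∫ y, gaussWeight y * (⟪y, U y⟫ * headPressure (1 / 2) U P y) := by
  intro U Us P α C hU hP hUs heq hdiv hΔP hUb hDUb hUsb hPb hgPb
  exact gaussianHeadPressure_slice_poly (N := 1) hU hP hUs heq hdiv hΔP hUb hDUb
    (fun y => by rw [pow_one]; exact hUsb y) (fun y => by rw [pow_one]; exact hPb y)
    (fun y => by rw [pow_one]; exact hgPb y)

end Summit.NavierStokesRegularity.NavierStokesRegularity.Theorems.GaussianHeadPressure

end
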